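import Summits.QuantumFields.YangMills.Theorems.UnitScaleTiltCoverDeckNaturality
import HarnessLib

/-!
# Route `UnitScaleTilt`, crux K1 child «MinimiserStabilityRegPr» (stmt-QuantumFields-19200), registered stub `stub_halvingStep` (H) — H-SMALL route (b7) «COVER LIFT»
# (★★OWNER RULINGS №28–№30), brick **DECK INVARIANCE OF THE COVER FIBRE**: the descent `D_{n,K}` on the cover member `F.cover jc` COMMUTES WITH THE DECK
# TRANSLATIONS, hence the (0.4)-fibre over a LIFTED datum `V ∘ π` is DECK-INVARIANT — a deck translate of a cover fibre curve is again a cover fibre curve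
# (the input `comp_deck_mem_fibre` of `ym-ust-20520-w3` g5's FILE 3b `…CoverLiftTangent`, asked 2026-08-28T12:04:08Z)

Cell `ym3-torus` (HUMAN RULING D-0037, YM ladder rung R3 — continuum SU(2) YM₃ on the torus is a RUNG, not the Clay problem); typed by the free reserve seat
`ym-inputs-p06` (g3) of desk `pub/ym-inputs`.  `--supports … --as helper`; def-free, 0 sorry, standard axioms.  NOT a claim about the stub, the crux, the rung or
a mass gap.

WHAT IS PROVED (deck letters of ✓`CoverDeckNaturality`: for `c : Fin P.d → ℕ`, the translation of `cover P jc` at level `i` is `x̃ ↦ fun ν => x̃ ν + ((c ν * P.sitesPerDir i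
: ℕ) : ZMod ((cover P jc).sitesPerDir i))`, its bond map `b̃ ↦ ⟨τ b̃.src, b̃.dir⟩`, both written inline).
* §1 `fieldShift_comp_deck` — the level identification `T3LevelShift.fieldShift` of the COVER family (a coordinatewise ring isomorphism along equal moduli) commutes with the
  deck translations: `fieldShift h′ (W̃ ∘ τ♭_{(K′,j′)}) = fieldShift h′ W̃ ∘ τ♭_{(K,j)}` (`coordEquiv` is additive and fixes the casts of naturals; the two base periods agree by `h`).
* §2 ★`descendTo_deck` — `D_{n,K}(W̃ ∘ τ♭_K) = D_{n,K}(W̃) ∘ τ♭_n` on `F.cover jc` (✓`CoverDeckNaturality.iter_blockAvg_comp_deck` + §1).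
* §3 ★★`comp_deck_mem_fibre` — for a LIFTED datum `V ∘ π`, `W̃ ∈ 𝔅_k(V ∘ π) ⇒ W̃ ∘ τ♭ ∈ 𝔅_k(V ∘ π)` (§2 + ✓`CoverDeckNaturality.comp_projBond_comp_deck` at the `n`-th tower).
HONEST SCOPE.  Finite-torus bookkeeping over landed bricks; no analysis; nothing of the H stub, the crux, T⁴ or a mass gap is claimed.

References: T. Bałaban, CMP **109** (1987) 249–301 [Balaban1987RG1] ((0.1) p.251, (0.11) p.253); CMP **102** (1985) 255–275 [Balaban1985UV3] ((41) p.266);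
CMP **102** (1985) 277–309 [Balaban1985Variational] ((3) p.278).
-/

set_option autoImplicit false

open scoped BigOperators

namespace Summit.QuantumFields.YangMills.Theorems.CoverDeckFibre

open Literature.MathematicalPhysics.QuantumFieldTheory.Balaban1983to89
open T4Continuum BlockAveraging
open T3ContinuumYM3Torus (T3Family)
open T3LevelShift (fieldShift fieldShift_apply bondShift siteShift coordEquiv coordEquiv_natCast)
open T3TiltDescent (descendTo)
open T3ConstrainedMinimiser (fibre)
open CoverSites
open CoverDeckNaturality (iter_blockAvg_comp_deck comp_projBond_comp_deck)

variable (F : T3Family) (jc : ℕ) (c : Fin 3 → ℕ)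

/-! ## §1 The level identification of the cover family commutes with the deck translations -/

/-- **`fieldShift` COMMUTES WITH THE DECK TRANSLATIONS** on the cover family `F.cover jc`: reading a height-`j′` field of the `K′`-th tower as a height-`j` field of the
`K`-th tower (equal moduli `h′` on the cover, `h` on the member) and translating by the deck vector `c·N` (the base period at that height — the SAME natural number on
both sides by `h`) commute. [cite: Balaban1987RG1, (0.1) p.251] -/
theorem fieldShift_comp_deck {G : Type*} {K j K' j' : ℕ}
    (h : (F.PP F.m K).sitesPerDir j = (F.PP F.m K').sitesPerDir j')
    (h' : ((F.cover jc).PP (F.m + jc) K).sitesPerDir j = ((F.cover jc).PP (F.m + jc) K').sitesPerDir j')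
    (W : GaugeField ((F.cover jc).P K') j' G) :
    fieldShift h' (W ∘ fun b : PBond (cover (F.P K') jc) j' =>
        (⟨fun ν => b.src ν + ((c ν * (F.P K').sitesPerDir j' : ℕ) : ZMod ((cover (F.P K') jc).sitesPerDir j')), b.dir⟩ : PBond (cover (F.P K') jc) j')) =
      fieldShift h' W ∘ fun b : PBond (cover (F.P K) jc) j =>
        (⟨fun ν => b.src ν + ((c ν * (F.P K).sitesPerDir j : ℕ) : ZMod ((cover (F.P K) jc).sitesPerDir j)), b.dir⟩ : PBond (cover (F.P K) jc) j) := by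
  funext b
  simp only [Function.comp_apply, fieldShift_apply]
  congr 1
  cases b with
  | mk src dir =>
    simp only [bondShift, siteShift, Equiv.coe_fn_mk]
    have hN : (F.P K).sitesPerDir j = (F.P K').sitesPerDir j' := h
    congr 1
    funext ν
    show coordEquiv h' (src ν) + ((c ν * (F.P K').sitesPerDir j' : ℕ) : ZMod (((F.cover jc).PP (F.m + jc) K').sitesPerDir j')) =
      coordEquiv h' (src ν + ((c ν * (F.P K).sitesPerDir j : ℕ) : ZMod (((F.cover jc).PP (F.m + jc) K).sitesPerDir j)))
    rw [map_add, map_natCast, hN]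

/-! ## §2 The descent on the cover commutes with the deck translations -/

/-- ★ **`D_{n,K}(W̃ ∘ τ♭_K) = D_{n,K}(W̃) ∘ τ♭_n` ON THE COVER MEMBER**: the (0.4) average is natural under the deck translations (✓`CoverDeckNaturality.iter_blockAvg_comp_deck`)
and so is the level identification (§1). [cite: Balaban1987RG1, (0.11) p.253; Balaban1985UV3, (41) p.266] -/
theorem descendTo_deck {G : Type*} [GaugeGroup G] (ℰ : LoopAverage G) {n K : ℕ} (hnK : n ≤ K) (W : GaugeField ((F.cover jc).P K) 0 G) :
    descendTo (F.cover jc) ℰ n K hnK (W ∘ fun b : PBond (cover (F.P K) jc) 0 =>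
        (⟨fun ν => b.src ν + ((c ν * (F.P K).sitesPerDir 0 : ℕ) : ZMod ((cover (F.P K) jc).sitesPerDir 0)), b.dir⟩ : PBond (cover (F.P K) jc) 0)) =
      descendTo (F.cover jc) ℰ n K hnK W ∘ fun b : PBond (cover (F.P n) jc) 0 =>
        (⟨fun ν => b.src ν + ((c ν * (F.P n).sitesPerDir 0 : ℕ) : ZMod ((cover (F.P n) jc).sitesPerDir 0)), b.dir⟩ : PBond (cover (F.P n) jc) 0) := by
  unfold T3TiltDescent.descendTo
  have hk : K - n ≤ (F.P K).m + (F.P K).K := by show K - n ≤ F.m + K; omega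
  rw [show Averaging.iter (fun i => blockAvg (P := (F.cover jc).P K) (j := i) ℰ) (K - n)
        (W ∘ fun b : PBond (cover (F.P K) jc) 0 =>
          (⟨fun ν => b.src ν + ((c ν * (F.P K).sitesPerDir 0 : ℕ) : ZMod ((cover (F.P K) jc).sitesPerDir 0)), b.dir⟩ : PBond (cover (F.P K) jc) 0)) =
      Averaging.iter (fun i => blockAvg (P := (F.cover jc).P K) (j := i) ℰ) (K - n) W ∘ fun b : PBond (cover (F.P K) jc) (K - n) =>
        (⟨fun ν => b.src ν + ((c ν * (F.P K).sitesPerDir (K - n) : ℕ) : ZMod ((cover (F.P K) jc).sitesPerDir (K - n))), b.dir⟩ : PBond (cover (F.P K) jc) (K - n))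
    from iter_blockAvg_comp_deck (F.P K) jc c ℰ W (K - n) hk]
  exact fieldShift_comp_deck F jc c (K := n) (j := 0) (K' := K) (j' := K - n)
    (F.sitesPerDir_eq (m := F.m) (K := n) (j := 0) (m' := F.m) (K' := K) (j' := K - n) (by omega)) _ _

/-! ## §3 The cover fibre over a lifted datum is deck-invariant -/

/-- ★★ **A DECK TRANSLATE OF A COVER FIBRE ELEMENT OVER A LIFTED DATUM IS A COVER FIBRE ELEMENT**: `W̃ ∈ 𝔅_k(V ∘ π) ⇒ W̃ ∘ τ♭ ∈ 𝔅_k(V ∘ π)` — the descent commutes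
with the translation (§2) and the lifted datum is deck-invariant (✓`CoverDeckNaturality.comp_projBond_comp_deck`).  So the deck translates of a cover fibre curve through the
lift `U ∘ π` are cover fibre curves through `U ∘ π`. [cite: Balaban1985Variational, (3) p.278; Balaban1987RG1, (0.1) p.251] -/
theorem comp_deck_mem_fibre {G : Type*} [GaugeGroup G] (ℰ : LoopAverage G) {n K : ℕ} (hnK : n ≤ K) (V : GaugeField (F.P n) 0 G)
    {W : GaugeField ((F.cover jc).P K) 0 G} (hW : W ∈ fibre (F.cover jc) ℰ n K hnK (V ∘ projBond (F.P n) jc 0)) :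
    (W ∘ fun b : PBond (cover (F.P K) jc) 0 =>
        (⟨fun ν => b.src ν + ((c ν * (F.P K).sitesPerDir 0 : ℕ) : ZMod ((cover (F.P K) jc).sitesPerDir 0)), b.dir⟩ : PBond (cover (F.P K) jc) 0)) ∈
      fibre (F.cover jc) ℰ n K hnK (V ∘ projBond (F.P n) jc 0) := by
  have hW' : descendTo (F.cover jc) ℰ n K hnK W = V ∘ projBond (F.P n) jc 0 := hW
  have h2 := descendTo_deck F jc c ℰ hnK W
  rw [hW'] at h2
  show descendTo (F.cover jc) ℰ n K hnK _ = V ∘ projBond (F.P n) jc 0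
  exact h2.trans (comp_projBond_comp_deck (F.P n) jc c V)

end Summit.QuantumFields.YangMills.Theorems.CoverDeckFibre
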